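import Summits.BirchSwinnertonDyer.BirchSwinnertonDyer.Theorems.PrintCFramBottomClassIndexLawFiveLeBorelHomothetyLevelP
import Summits.BirchSwinnertonDyer.BirchSwinnertonDyer.Theorems.PrintCFramBottomClassIndexLawFiveLeBorelNoPTorsionInputs
import Summits.BirchSwinnertonDyer.BirchSwinnertonDyer.Theorems.PrintCFramBottomClassIndexLawFiveLeRationalPIsogeny
import HarnessLib

/-!
# Route `PrintCFram`, crux C2 `BottomClassIndexLawFiveLe` (stmt-BirchSwinnertonDyer-20372), line
# `eisenstein-resource-bdp-line` (v7 stub S2 `stub_kolyvaginUpper_borelCM`): GJPST Prop. 5.2 AT THE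
# BOREL CM-RAMIFIED PRIME — for every CM curve `W/ℚ` with `p ≥ 5` ramified in the CM field, EVERY
# quadratic field `K` and EVERY level `p^M`: `H¹(K(E[p^M])/K, E[p^M]) = 0` (restriction injective) and
# `E[p^M]^{Γ_K} = 0`, by a central homothety; plus `√−p ∈ End E(ℚ̄)` on the leaf
# (cell `bsd-print-cfram`, seat `bsd-line-cfram-p1-w2` g5; helper `--supports` 20372; 0 facts, 0 defs)

HONEST FRAMING. Nothing about BSD is proved here; in particular S2 (Kolyvagin's UPPER index
inequality at the Borel prime) is NOT proved — its visibility step (Gross Prop. 5.3 analogue, the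
invisible `τ`-eigenline; Matar–Nekovář 2019 §0.10–0.11) is untouched. What IS proved (file 3/3):

* §5 **`exists_sqrt_end_of_cmRamified`** — on the leaf (`W.HasCM`, `CMRamified W p`, `5 ≤ p`;
  seven `j`-invariants incl. `16581375`): `s = √−p ∈ ℚ̄` and an additive endomorphism `μ` of `W(ℚ̄)`
  with `μ ∘ μ = [m]`, `|m| = p`, commuting with `Γ_{ℚ(√−p)}` and anti-commuting with its complement —
  the tree's twist endomorphism of the certified isogenies `E → E^{(−p)}` (`cert7`, …, `cert163`);
  the `𝓞_𝔭`-structure on `E[p^∞]` that the line's device (γ) asks for.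
* §7 over a quadratic field `K` (`[K:ℚ] = 2`), two routes to a level-`p` homothety, then the lift
  `E[p] ⇝ E[p^M]` (file 1/3 §1) and transport to `E(K̄)` (`RatClosure.torsionEquiv`):
  (I) w4 g2's inertia homothety `BorelTorsion.exists_sq_mem_inertia_homothety` (EVERY quadratic `K`) ⟹
  **`exists_central_homothety_of_cmRamified`** (∀ `M ≥ 1` ∃ `g₀ ∈ Γ_K`, `d`, `(d − 1, p^M) = 1`, `g₀`
  acts on `E[p^M]` as `d`), **`subgroupResKer_torsionFixing_eq_bot_of_cmRamified`** —
  `ker (H¹(K, E[p^M]) → H¹(K(E[p^M]), E[p^M])) = 0` (GJPST Prop. 5.2 with the Borel image — what the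
  tree's Kolyvagin machine takes from `HasSurjectiveModNGaloisRep`; Sah's lemma, file 1/3 §2),
  **`geomTorsion_eq_zero_of_forall_smul_eq_of_cmRamified`** — `E[p^M]^{Γ_K} = 0`;
  (II) the global `√−p`-route of §5 + file 2/3 (`K ∌ √−p`, e.g. every Heegner field):
  `exists_restrict_smul_eq_of_cmRamified` (`h·c·h·c⁻¹` acts on `E[p]` as `χ̄_p(h) ≢ 1`) and
  `exists_central_homothety_of_cmRamified_of_sqrt` (level `p^M`; `subgroupResKer … = ⊥` again).

No surjectivity, no Chebotarev, no CM main theorem; `E(K)[p] = 0` itself is w4 g2's and is not restated.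
THEOREMS ONLY; 0 defs, 0 facts, no `sorry`; imports no `Theses` module. BSD is not proved by any of this.
References: [GrigorovJorzaPatrikisSteinTarnita2009] Props. 5.2, 5.4; [MatarNekovar2019] §0.10–0.11;
[Rubin1999] Lemma 6.2; [SilvermanAEC2009] X.5 Prop. 5.4, III.4; [SilvermanATAEC1994] App. A §3. -/

set_option autoImplicit false
-- `…BirchSwinnertonDyer.BirchSwinnertonDyer.Theorems…` is the problem's mandated namespace (D-0017).
set_option linter.dupNamespace false

noncomputable section

open scoped Classical Matrix

namespace Summit.BirchSwinnertonDyer.BirchSwinnertonDyer.Theorems.PrintCFram.BorelHomothety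

open WeierstrassCurve Field Literature.NumberTheory.EllipticCurves
  Literature.NumberTheory.GaloisRepresentations

universe u

/-! ## §5 The leaf: the twist endomorphism `μ = √−p` on `E(ℚ̄)` for every CM curve with `p ∣ d_K`, `p ≥ 5` -/

section LeafMu

open Literature.NumberTheory.EllipticCurves.PolyCert Literature.NumberTheory.EllipticCurves.CMIsogenyCert
  Literature.NumberTheory.EllipticCurves.Rank1Residual Summit.BirchSwinnertonDyer.Rank1Residual.X12.O11

/-- **A square root of `D` in `End E(ℚ̄)` from a `ℚ`-isogeny `λ : E → E' = E^{(D)}` of degree `N`**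
(`E` short, `j ≠ 0, 1728`), on any `W/ℚ` with `j(W) = j(E)`: `s = √D ∈ ℚ̄` and an additive `μ` on
`W(ℚ̄)` with `μ ∘ μ = [m]`, `|m| = N`, commuting with the `g ∈ Γ_ℚ` fixing `s`, anti-commuting with
those negating `s` (the tree's twist endomorphism `DeuringLadic.exists_twist_end`, transported; the
first half of `DeuringLadic.exists_natAbs_eq_and_mul_eq_sq` with `μ` as output).
[cite: SilvermanAEC2009, X.5 Prop. 5.4 and III.4 (isogenies, twists)] -/
theorem exists_sqrt_end_of_isogeny_twist {E E' : WeierstrassCurve ℚ} [E.IsElliptic] [E'.IsElliptic]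
    (lam : Isogeny E E') {N : ℕ} (hN : lam.degree = N) (ha₁ : E.a₁ = 0) (ha₃ : E.a₃ = 0)
    {D : ℤ} (hD : D ≠ 0)
    (hE' : E' = ⟨0, (D : ℚ) * E.a₂, 0, (D : ℚ) ^ 2 * E.a₄, (D : ℚ) ^ 3 * E.a₆⟩)
    (W : WeierstrassCurve ℚ) [W.IsElliptic] (hj : W.j = E.j) (h0 : E.j ≠ 0) (h1728 : E.j ≠ 1728) :
    ∃ (s : AlgebraicClosure ℚ) (μ : AddMonoid.End W.geomPoints) (m : ℤ),
      s ^ 2 = ((D : ℤ) : AlgebraicClosure ℚ) ∧ m.natAbs = N ∧ (∀ P, μ (μ P) = m • P) ∧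
      (∀ g : absoluteGaloisGroup ℚ, g • s = s → ∀ P, μ (g • P) = g • μ P) ∧
      (∀ g : absoluteGaloisGroup ℚ, g • s = -s → ∀ P, μ (g • P) = -(g • μ P)) := by
  obtain ⟨s, hs⟩ := IsAlgClosed.exists_pow_nat_eq ((D : ℤ) : (AlgebraicClosure ℚ)) two_pos
  have hsQ : s ^ 2 = algebraMap ℚ (AlgebraicClosure ℚ) (D : ℚ) := by rw [hs, map_intCast]
  have hs0 : s ≠ 0 := by
    rintro rfl
    rw [zero_pow two_ne_zero, eq_comm, Int.cast_eq_zero] at hs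
    exact hD hs
  -- the twisting change of variables `C = (s⁻¹, 0, 0, 0)`: `C • E = E'` over `ℚ̄`
  set C : VariableChange (AlgebraicClosure ℚ) := ⟨Units.mk0 s⁻¹ (inv_ne_zero hs0), 0, 0, 0⟩ with hCdef
  have hCu : ((C.u : (AlgebraicClosure ℚ)ˣ) : (AlgebraicClosure ℚ)) = s⁻¹ := rfl
  have hinv : ((Units.mk0 s⁻¹ (inv_ne_zero hs0))⁻¹ : (AlgebraicClosure ℚ)ˣ) = Units.mk0 s hs0 :=
    Units.ext (by simp)
  have hC : C • E.baseChange (AlgebraicClosure ℚ) = E'.baseChange (AlgebraicClosure ℚ) := by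
    rw [hE']
    ext
    · simp [hCdef, baseChange, ha₁, variableChange_a₁]
    · simp only [hCdef, variableChange_a₂, baseChange, map_a₁, map_a₂, hinv, Units.val_mk0, map_mul,
        map_intCast, ha₁, map_zero, mul_zero, sub_zero, add_zero, zero_pow two_ne_zero, ← hs]
    · simp [hCdef, baseChange, ha₃, variableChange_a₃]
    · simp only [hCdef, variableChange_a₄, baseChange, map_a₁, map_a₂, map_a₃, map_a₄, hinv,
        Units.val_mk0, map_mul, map_pow, map_intCast, ha₁, ha₃, map_zero, mul_zero, zero_mul,
        sub_zero, add_zero, zero_pow two_ne_zero, ← hs]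
      ring
    · simp only [hCdef, variableChange_a₆, baseChange, map_a₁, map_a₂, map_a₃, map_a₄, map_a₆, hinv,
        Units.val_mk0, map_mul, map_pow, map_intCast, ha₁, ha₃, map_zero, mul_zero, zero_mul,
        sub_zero, add_zero, zero_pow two_ne_zero, zero_pow three_ne_zero, ← hs]
      ring
  have ha₁' : E'.a₁ = 0 := by rw [hE']
  have ha₃' : E'.a₃ = 0 := by rw [hE']
  obtain ⟨μ, halg, hsurj, hker, h₁, h₂⟩ := DeuringLadic.exists_twist_end lam ha₁' ha₃' C hC hCu rfl rfl rfl
  obtain ⟨m, hμm⟩ := DeuringLadic.exists_mul_self_eq_intCast E hsQ halg h₁ h₂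
  have hμμ : ∀ P, μ (μ P) = m • P := fun P =>
    (congrArg (fun φ : AddMonoid.End E.geomPoints => φ P) hμm).trans (AddMonoid.End.intCast_apply m P)
  have hm0 : m ≠ 0 := by
    rintro rfl
    obtain ⟨P, hP⟩ := exists_ne (0 : E.geomPoints)
    obtain ⟨Q, rfl⟩ := hsurj P
    obtain ⟨R, rfl⟩ := hsurj Q
    exact hP (by rw [hμμ, zero_smul])
  have hkerN : Nat.card (μ : E.geomPoints →+ E.geomPoints).ker = N := by
    rw [← hN]
    unfold Isogeny.degree
    congr 2
    ext P
    exact hker P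
  have hmN : m.natAbs = N := DeuringLadic.natAbs_eq_of_mul_self_eq_intCast E hsurj hkerN hμm hm0
  obtain ⟨ι, hι⟩ := DeuringLadic.exists_iso_of_j_eq hj h0 h1728 ha₁ ha₃
  obtain ⟨μ', hμ'μ', h₁', h₂'⟩ := DeuringLadic.exists_transport_end ι hι hμm h₁ h₂
  exact ⟨s, μ', m, hs, hmN, hμ'μ', h₁', h₂'⟩

variable (W : WeierstrassCurve ℚ) [W.IsElliptic] (p : ℕ) [hp : Fact p.Prime]

omit hp in
/-- Short models `⟨0, 0, 0, a₄, a₆⟩`: the twist by `D` is `⟨0, 0, 0, D² a₄, D³ a₆⟩`. [folklore] -/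
theorem twist_short_eq (a₄ a₆ : ℚ) (D : ℤ) (b₄ b₆ : ℚ) (h₄ : (D : ℚ) ^ 2 * a₄ = b₄)
    (h₆ : (D : ℚ) ^ 3 * a₆ = b₆) :
    (⟨0, 0, 0, b₄, b₆⟩ : WeierstrassCurve ℚ) =
      ⟨0, (D : ℚ) * (⟨0, 0, 0, a₄, a₆⟩ : WeierstrassCurve ℚ).a₂, 0,
        (D : ℚ) ^ 2 * (⟨0, 0, 0, a₄, a₆⟩ : WeierstrassCurve ℚ).a₄,
        (D : ℚ) ^ 3 * (⟨0, 0, 0, a₄, a₆⟩ : WeierstrassCurve ℚ).a₆⟩ := by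
  ext <;> simp [h₄, h₆]

/-- **`√−p ∈ End E(ℚ̄)` on the leaf.** For `W/ℚ` elliptic with CM and `p ≥ 5` ramified in the CM
field (`p ∈ {7, 11, 19, 43, 67, 163}`): `s = √−p ∈ ℚ̄` and an additive endomorphism `μ` of `W(ℚ̄)`
with `μ ∘ μ = [m]`, `|m| = p`, commuting with `Γ_{ℚ(√−p)}` and anti-commuting with its complement —
from the certified `p`-isogenies `E → E^{(−p)}` of the seven leaf models (`cert7`, …, `cert163`).
[cite: SilvermanATAEC1994, App. A §3 (table of CM j-invariants)] [cite: SilvermanAEC2009, X.5 Prop. 5.4] -/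
theorem exists_sqrt_end_of_cmRamified (hCM : W.HasCM) (h5 : 5 ≤ p) (hram : CMRamified W p) :
    ∃ (s : AlgebraicClosure ℚ) (μ : AddMonoid.End W.geomPoints) (m : ℤ),
      s ^ 2 = ((-(p : ℤ) : ℤ) : AlgebraicClosure ℚ) ∧ m.natAbs = p ∧ (∀ P, μ (μ P) = m • P) ∧
      (∀ g : absoluteGaloisGroup ℚ, g • s = s → ∀ P, μ (g • P) = g • μ P) ∧
      (∀ g : absoluteGaloisGroup ℚ, g • s = -s → ∀ P, μ (g • P) = -(g • μ P)) := by
  have hj13 : W.j ∈ cmJInvariants := (hasCM_iff_j_mem_holds W).mp hCM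
  obtain ⟨-, hd, -⟩ := LeafInterface.leaf_arith W p hCM h5 hram
  have hp0 : (-(p : ℤ)) ≠ 0 := by have := hp.out.pos; omega
  simp only [cmJInvariants, Finset.mem_insert, Finset.mem_singleton] at hj13
  rcases hj13 with h | h | h | h | h | h | h | h | h | h | h | h | h <;>
    rw [h] at hd <;> norm_num [cmFieldDiscrOfJ] at hd
  all_goals first | (exfalso; omega) | skip
  · -- j = -3375 (p = 7), `cert7`
    obtain rfl : p = 7 := by omega
    haveI := isElliptic_cert7
    haveI := isElliptic_cert7'
    obtain ⟨ψ, hψ⟩ := DeuringLadic.exists_isogeny_degree_eq_of_cert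
      (E := (⟨0, 0, 0, -2835, -71442⟩ : WeierstrassCurve ℚ))
      (E' := (⟨0, 0, 0, -138915, 24504606⟩ : WeierstrassCurve ℚ)) cert7 checkFast_cert7 cert7Cop
      checkCoprime_cert7 (by rw [DeuringLadic.cert7Cop_ℓ]; norm_num)
      (by rw [cert7_a₁, cert7_a₂, cert7_a₃, cert7_a₄, cert7_a₆]; norm_num)
      (by rw [cert7_a₁', cert7_a₂', cert7_a₃', cert7_a₄', cert7_a₆']; norm_num)
    have hjE : (⟨0, 0, 0, -2835, -71442⟩ : WeierstrassCurve ℚ).j = -3375 := j_cert7 rfl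
    exact exists_sqrt_end_of_isogeny_twist ψ hψ rfl rfl hp0
      (twist_short_eq _ _ _ _ _ (by norm_num) (by norm_num)) W (by rw [h, hjE]) (by rw [hjE]; norm_num)
      (by rw [hjE]; norm_num)
  · -- j = 8000: `d_K = -8 = -p` is impossible for a prime `p`
    exfalso
    have hp8 : p = 8 := by omega
    exact absurd hp.out (by rw [hp8]; norm_num)
  · -- j = -32768, p = 11, `cert11`
    obtain rfl : p = 11 := by omega
    haveI := isElliptic_cert11
    haveI := isElliptic_cert11'
    obtain ⟨ψ, hψ⟩ := DeuringLadic.exists_isogeny_degree_eq_of_cert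
      (E := (⟨0, 0, 0, -9504, 365904⟩ : WeierstrassCurve ℚ))
      (E' := (⟨0, 0, 0, -1149984, -487018224⟩ : WeierstrassCurve ℚ)) cert11 checkFast_cert11
      cert11Cop checkCoprime_cert11 (by rw [cert11Cop_ℓ]; norm_num)
      (by rw [cert11_a₁, cert11_a₂, cert11_a₃, cert11_a₄, cert11_a₆]; norm_num)
      (by rw [cert11_a₁', cert11_a₂', cert11_a₃', cert11_a₄', cert11_a₆']; norm_num)
    have hjE : (⟨0, 0, 0, -9504, 365904⟩ : WeierstrassCurve ℚ).j = -32768 := j_cert11 rfl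
    exact exists_sqrt_end_of_isogeny_twist ψ hψ rfl rfl hp0
      (twist_short_eq _ _ _ _ _ (by norm_num) (by norm_num)) W (by rw [h, hjE]) (by rw [hjE]; norm_num)
      (by rw [hjE]; norm_num)
  · -- j = -884736, p = 19, `cert19`
    obtain rfl : p = 19 := by omega
    haveI := isElliptic_cert19
    haveI := isElliptic_cert19'
    obtain ⟨ψ, hψ⟩ := DeuringLadic.exists_isogeny_degree_eq_of_cert
      (E := (⟨0, 0, 0, -608, 5776⟩ : WeierstrassCurve ℚ))
      (E' := (⟨0, 0, 0, -219488, -39617584⟩ : WeierstrassCurve ℚ)) cert19 checkFast_cert19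
      cert19Cop checkCoprime_cert19 (by rw [cert19Cop_ℓ]; norm_num)
      (by rw [cert19_a₁, cert19_a₂, cert19_a₃, cert19_a₄, cert19_a₆]; norm_num)
      (by rw [cert19_a₁', cert19_a₂', cert19_a₃', cert19_a₄', cert19_a₆']; norm_num)
    have hjE : (⟨0, 0, 0, -608, 5776⟩ : WeierstrassCurve ℚ).j = -884736 := j_cert19 rfl
    exact exists_sqrt_end_of_isogeny_twist ψ hψ rfl rfl hp0
      (twist_short_eq _ _ _ _ _ (by norm_num) (by norm_num)) W (by rw [h, hjE]) (by rw [hjE]; norm_num)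
      (by rw [hjE]; norm_num)
  · -- j = 16581375, p = 7, the order `ℤ[√−7]`, `cert28`
    obtain rfl : p = 7 := by omega
    haveI := isElliptic_cert28
    haveI := isElliptic_cert28'
    obtain ⟨ψ, hψ⟩ := DeuringLadic.exists_isogeny_degree_eq_of_cert
      (E := (⟨0, 0, 0, -48195, -4072194⟩ : WeierstrassCurve ℚ))
      (E' := (⟨0, 0, 0, -2361555, 1396762542⟩ : WeierstrassCurve ℚ)) cert28 checkFast_cert28
      cert28Cop checkCoprime_cert28 (by rw [cert28Cop_ℓ]; norm_num)
      (by rw [cert28_a₁, cert28_a₂, cert28_a₃, cert28_a₄, cert28_a₆]; norm_num)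
      (by rw [cert28_a₁', cert28_a₂', cert28_a₃', cert28_a₄', cert28_a₆']; norm_num)
    have hjE : (⟨0, 0, 0, -48195, -4072194⟩ : WeierstrassCurve ℚ).j = 16581375 := j_cert28 rfl
    exact exists_sqrt_end_of_isogeny_twist ψ hψ rfl rfl hp0
      (twist_short_eq _ _ _ _ _ (by norm_num) (by norm_num)) W (by rw [h, hjE]) (by rw [hjE]; norm_num)
      (by rw [hjE]; norm_num)
  · -- j = -884736000, p = 43, `cert43`
    obtain rfl : p = 43 := by omega
    haveI := isElliptic_cert43
    haveI := isElliptic_cert43'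
    obtain ⟨ψ, hψ⟩ := DeuringLadic.exists_isogeny_degree_eq_of_cert
      (E := (⟨0, 0, 0, -13760, 621264⟩ : WeierstrassCurve ℚ))
      (E' := (⟨0, 0, 0, -25442240, -49394836848⟩ : WeierstrassCurve ℚ)) cert43 checkFast_cert43
      cert43Cop checkCoprime_cert43 (by rw [cert43Cop_ℓ]; norm_num)
      (by rw [cert43_a₁, cert43_a₂, cert43_a₃, cert43_a₄, cert43_a₆]; norm_num)
      (by rw [cert43_a₁', cert43_a₂', cert43_a₃', cert43_a₄', cert43_a₆']; norm_num)
    have hjE : (⟨0, 0, 0, -13760, 621264⟩ : WeierstrassCurve ℚ).j = -884736000 := j_cert43 rfl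
    exact exists_sqrt_end_of_isogeny_twist ψ hψ rfl rfl hp0
      (twist_short_eq _ _ _ _ _ (by norm_num) (by norm_num)) W (by rw [h, hjE]) (by rw [hjE]; norm_num)
      (by rw [hjE]; norm_num)
  · -- j = -147197952000, p = 67, `cert67`
    obtain rfl : p = 67 := by omega
    haveI := isElliptic_cert67
    haveI := isElliptic_cert67'
    obtain ⟨ψ, hψ⟩ := DeuringLadic.exists_isogeny_degree_eq_of_cert
      (E := (⟨0, 0, 0, -117920, 15585808⟩ : WeierstrassCurve ℚ))
      (E' := (⟨0, 0, 0, -529342880, -4687634371504⟩ : WeierstrassCurve ℚ)) cert67 checkFast_cert67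
      cert67Cop checkCoprime_cert67 (by rw [cert67Cop_ℓ]; norm_num)
      (by rw [cert67_a₁, cert67_a₂, cert67_a₃, cert67_a₄, cert67_a₆]; norm_num)
      (by rw [cert67_a₁', cert67_a₂', cert67_a₃', cert67_a₄', cert67_a₆']; norm_num)
    have hjE : (⟨0, 0, 0, -117920, 15585808⟩ : WeierstrassCurve ℚ).j = -147197952000 := j_cert67 rfl
    exact exists_sqrt_end_of_isogeny_twist ψ hψ rfl rfl hp0
      (twist_short_eq _ _ _ _ _ (by norm_num) (by norm_num)) W (by rw [h, hjE]) (by rw [hjE]; norm_num)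
      (by rw [hjE]; norm_num)
  · -- j = -262537412640768000, p = 163, `cert163`
    obtain rfl : p = 163 := by omega
    haveI := isElliptic_cert163
    haveI := isElliptic_cert163'
    obtain ⟨ψ, hψ⟩ := DeuringLadic.exists_isogeny_degree_eq_of_cert
      (E := (⟨0, 0, 0, -34790720, 78984748304⟩ : WeierstrassCurve ℚ))
      (E' := (⟨0, 0, 0, -924354639680, -342062961763303088⟩ : WeierstrassCurve ℚ)) cert163
      checkFast_cert163 cert163Cop checkCoprime_cert163 (by rw [cert163Cop_ℓ]; norm_num)
      (by rw [cert163_a₁, cert163_a₂, cert163_a₃, cert163_a₄, cert163_a₆]; norm_num)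
      (by rw [cert163_a₁', cert163_a₂', cert163_a₃', cert163_a₄', cert163_a₆']; norm_num)
    have hjE : (⟨0, 0, 0, -34790720, 78984748304⟩ : WeierstrassCurve ℚ).j = -262537412640768000 := j_cert163 rfl
    have hψ' : ψ.degree = 163 := by
      rw [hψ]; exact (show cert163.U.length - 1 = 163 by decide +kernel)
    exact exists_sqrt_end_of_isogeny_twist ψ hψ' rfl rfl hp0
      (twist_short_eq _ _ _ _ _ (by norm_num) (by norm_num)) W (by rw [h, hjE]) (by rw [hjE]; norm_num)
      (by rw [hjE]; norm_num)

end LeafMu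

/-! ## §7 Assembly over a quadratic field `K`: the central homothety at every level `p^M` (two routes
to level `p`: (I) w4 g2's inertia square, every quadratic `K`; (II) the global `√−p`-route, `K ∌ √−p`) -/

section Assembly

open Literature.NumberTheory.EllipticCurves.Rank1Residual Summit.BirchSwinnertonDyer.Rank1Residual.X12.O11
  Summit.BirchSwinnertonDyer.BirchSwinnertonDyer.Theorems.PrintCFram

variable (W : WeierstrassCurve ℚ) [W.IsElliptic] (p : ℕ) [hp : Fact p.Prime]
  (K : Type) [Field K] [NumberField K]

omit [W.IsElliptic] in
/-- **Lift and transport.** If `res σ` (`σ ∈ Γ_K`) acts on `E[p] ⊂ E(ℚ̄)` as an integer `d ≢ 1 (mod p)`,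
then `σ^{p^{M−1}}` acts on `E[p^M] ⊂ E(K̄)` as `d^{p^{M−1}}`, and `(d^{p^{M−1}} − 1, p^M) = 1`. [folklore] -/
theorem homothety_pow_of_level_one {σ : absoluteGaloisGroup K} {d : ℤ}
    (hd : ¬ (p : ℤ) ∣ d - 1)
    (hσ : ∀ x : W.geomPoints, p • x = 0 → absGaloisRestrict ℚ K σ • x = d • x) {M : ℕ} (hM : 1 ≤ M) :
    IsCoprime (d ^ (p ^ (M - 1)) - 1) ((p ^ M : ℕ) : ℤ) ∧
      ∀ P : geomTorsion (W.baseChange K) ((p ^ M : ℕ) : ℤ),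
        σ ^ (p ^ (M - 1)) • P = d ^ (p ^ (M - 1)) • P := by
  have hpr : p.Prime := hp.out
  haveI : NeZero p := ⟨hpr.ne_zero⟩
  have hlift := smul_pow_eq_of_smul_eq (G := absoluteGaloisGroup ℚ) (A := W.geomPoints)
    (g := absGaloisRestrict ℚ K σ) (d := d) hσ hM
  refine ⟨?_, fun P => ?_⟩
  · have hp' : Prime (p : ℤ) := Nat.prime_iff_prime_int.mp hpr
    have hnd : ¬ (p : ℤ) ∣ d ^ (p ^ (M - 1)) - 1 := by
      intro hdvd
      apply hd
      have h1 : ((d ^ (p ^ (M - 1)) - 1 : ℤ) : ZMod p) = 0 :=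
        (ZMod.intCast_zmod_eq_zero_iff_dvd _ p).mpr hdvd
      rw [Int.cast_sub, Int.cast_pow, ZMod.pow_card_pow, ← Int.cast_sub] at h1
      exact (ZMod.intCast_zmod_eq_zero_iff_dvd _ p).mp h1
    have hcop : IsCoprime (d ^ (p ^ (M - 1)) - 1) (p : ℤ) :=
      ((Irreducible.coprime_iff_not_dvd hp'.irreducible).mpr hnd).symm
    rw [Nat.cast_pow]
    exact hcop.pow_right
  · obtain ⟨Q, rfl⟩ := (RatClosure.torsionEquiv (K := K) W ((p ^ M : ℕ) : ℤ)).surjective P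
    rw [← RatClosure.torsionEquiv_smul, ← map_zsmul]
    congr 1
    refine Subtype.ext ?_
    change absGaloisRestrict ℚ K (σ ^ (p ^ (M - 1))) • (Q : W.geomPoints) =
      d ^ (p ^ (M - 1)) • (Q : W.geomPoints)
    rw [map_pow]
    exact hlift Q (AddSubgroup.torsionBy.nsmul_iff.mp Q.2)

/-- **THE CENTRAL HOMOTHETY at every level (route I: inertia).** For `W/ℚ` with CM, `p ≥ 5`
ramified in the CM field, EVERY quadratic field `K` and every `M ≥ 1`: some `g₀ ∈ Γ_K` acts on
`E[p^M]` as an integer `d` with `(d − 1, p^M) = 1` (level `p`: w4 g2's inertia homothety, a square of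
`Γ_ℚ`, hence in `res Γ_K`; then file 1/3 §1). [cite: GrigorovJorzaPatrikisSteinTarnita2009, Prop. 5.4 (mechanism)] -/
theorem exists_central_homothety_of_cmRamified (hCM : W.HasCM) (h5 : 5 ≤ p) (hram : CMRamified W p)
    (hK2 : Module.finrank ℚ K = 2) {M : ℕ} (hM : 1 ≤ M) :
    ∃ (g₀ : absoluteGaloisGroup K) (d : ℤ), IsCoprime (d - 1) ((p ^ M : ℕ) : ℤ) ∧
      ∀ P : geomTorsion (W.baseChange K) ((p ^ M : ℕ) : ℤ), g₀ • P = d • P := by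
  obtain ⟨v, hv, 𝔓, h𝔓⟩ := BorelTorsion.exists_place_mem_and_primesAbove p
  obtain ⟨g, -, ⟨h, rfl⟩, c, hc1, hg⟩ :=
    BorelTorsion.exists_sq_mem_inertia_homothety (W := W) (p := p) hCM h5 hram hv h𝔓
  obtain ⟨σ, hσ⟩ := LineCharacter.sq_mem_range_absGaloisRestrict_of_finrank_eq_two K hK2 h
  have hσ' : ∀ x : W.geomPoints, p • x = 0 → absGaloisRestrict ℚ K σ • x = c • x := fun x hx => by
    have hx' := congrArg Subtype.val (hg ⟨x, AddSubgroup.torsionBy.nsmul_iff.mpr hx⟩)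
    have hσg : absGaloisRestrict ℚ K σ = h * h := hσ
    rw [hσg]
    exact hx'
  obtain ⟨hcop, hpow⟩ := homothety_pow_of_level_one W p K hc1 hσ' hM
  exact ⟨σ ^ (p ^ (M - 1)), c ^ (p ^ (M - 1)), hcop, hpow⟩

/-- **GJPST Prop. 5.2 at the Borel CM-ramified prime: `H¹(K(E[p^M])/K, E[p^M]) = 0`** (restriction
`H¹(K, E[p^M]) → H¹(K(E[p^M]), E[p^M])` injective) — for EVERY CM curve `W/ℚ` with `p ≥ 5` ramified in
the CM field (`ρ̄_{W,p}` Borel, non-semisimple), EVERY quadratic `K`, EVERY level `p^M`: what the tree's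
Kolyvagin machine takes from `HasSurjectiveModNGaloisRep`, here from the homothety and Sah (1/3 §2).
[cite: GrigorovJorzaPatrikisSteinTarnita2009, Prop. 5.2 and Prop. 5.4] [cite: Rubin1999, Lemma 6.2 (i)] -/
theorem subgroupResKer_torsionFixing_eq_bot_of_cmRamified (hCM : W.HasCM) (h5 : 5 ≤ p)
    (hram : CMRamified W p) (hK2 : Module.finrank ℚ K = 2) {M : ℕ} (hM : 1 ≤ M) :
    subgroupResKer (geomTorsion (W.baseChange K) ((p ^ M : ℕ) : ℤ))
      (torsionFixing (W.baseChange K) ((p ^ M : ℕ) : ℤ)) = ⊥ := by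
  obtain ⟨g₀, d, hd, hg⟩ := exists_central_homothety_of_cmRamified W p K hCM h5 hram hK2 hM
  haveI : (W.baseChange K).IsElliptic := by unfold WeierstrassCurve.baseChange; infer_instance
  exact subgroupResKer_torsionFixing_eq_bot_of_smul_eq (W.baseChange K) (pow_ne_zero M hp.out.ne_zero)
    hg hd

/-- **`E[p^M]^{Γ_K} = 0`** on the leaf over every quadratic `K`, every `M ≥ 1` (the level-`p^M` form
of w4 g2's `BorelTorsion.torsionBy_eq_bot_of_finrank_eq_two`, in the `geomTorsion` currency of the
Kolyvagin machine). [cite: GrigorovJorzaPatrikisSteinTarnita2009, Prop. 5.2] -/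
theorem geomTorsion_eq_zero_of_forall_smul_eq_of_cmRamified (hCM : W.HasCM) (h5 : 5 ≤ p)
    (hram : CMRamified W p) (hK2 : Module.finrank ℚ K = 2) {M : ℕ} (hM : 1 ≤ M)
    (P : geomTorsion (W.baseChange K) ((p ^ M : ℕ) : ℤ))
    (hP : ∀ σ : absoluteGaloisGroup K, σ • P = P) : P = 0 := by
  obtain ⟨g₀, d, hd, hg⟩ := exists_central_homothety_of_cmRamified W p K hCM h5 hram hK2 hM
  exact eq_zero_of_forall_smul_eq_of_smul_eq (W.baseChange K) hg hd P (hP g₀)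

/-- **Route II (global): level `p` from `√−p`.** For `W` on the leaf and `K` quadratic with
`−p ∉ K²`: `g = h·c·h·c⁻¹ ∈ Γ_K` and `d ≢ 1 (mod p)` (a lift of `χ̄_p(h)`) with `res g` acting on `E[p]`
as `d` (§5, file 2/3; no inertia group). [cite: GrigorovJorzaPatrikisSteinTarnita2009, Prop. 5.4 (mechanism)] -/
theorem exists_restrict_smul_eq_of_cmRamified (hCM : W.HasCM) (h5 : 5 ≤ p) (hram : CMRamified W p)
    (hK2 : Module.finrank ℚ K = 2) (hKp : ∀ y : K, y ^ 2 ≠ -(p : K)) :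
    ∃ (g : absoluteGaloisGroup K) (d : ℤ), ¬ (p : ℤ) ∣ d - 1 ∧
      ∀ P : W.geomPoints, p • P = 0 → absGaloisRestrict ℚ K g • P = d • P := by
  haveI : NeZero p := ⟨hp.out.ne_zero⟩
  obtain ⟨hp7, -, -⟩ := LeafInterface.leaf_arith W p hCM h5 hram
  have h7 : 7 ≤ p := by rcases hp7 with rfl | rfl | rfl | rfl | rfl | rfl <;> norm_num
  obtain ⟨s, μ, m, hs, hm, hμμ, hcomm, hanti⟩ := exists_sqrt_end_of_cmRamified W p hCM h5 hram
  obtain ⟨c, hc⟩ := exists_restrict_smul_eq_neg p K hKp hs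
  obtain ⟨h, hhs, hχ⟩ := exists_restrict_smul_eq_self_cyclotomic_ne_one p K hK2 h7 hs
  have hpm : (p : ℤ) ∣ m := by rw [Int.natCast_dvd, hm]
  have hμ0 := exists_mem_geomTorsion_apply_ne_zero W p hμμ hm
  obtain ⟨d, hd, hsmul⟩ :=
    exists_smul_eq_cyclotomic_smul W p hpm hμμ hμ0 (hcomm _ hhs) (hanti _ hc)
  refine ⟨h * c * h * c⁻¹, d, fun hdvd => hχ ?_, fun P hP => ?_⟩
  · have h1 : ((d - 1 : ℤ) : ZMod p) = 0 := (ZMod.intCast_zmod_eq_zero_iff_dvd (d - 1) p).mpr hdvd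
    rw [Int.cast_sub, Int.cast_one, sub_eq_zero, hd] at h1
    exact Units.ext h1
  · have hmem : P ∈ geomTorsion W (p : ℤ) := AddSubgroup.torsionBy.nsmul_iff.mpr hP
    have hQ := congrArg Subtype.val (hsmul ⟨P, hmem⟩)
    rw [map_mul, map_mul, map_mul, map_inv]
    exact hQ

/-- **Route II at every level `p^M`** (`K` quadratic, `−p ∉ K²`): the central homothety
`(h·c·h·c⁻¹)^{p^{M−1}}` acting as `d^{p^{M−1}}`, and `subgroupResKer … = ⊥` again — a second, purely
global proof of that case. [cite: GrigorovJorzaPatrikisSteinTarnita2009, Prop. 5.4 (mechanism)] -/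
theorem exists_central_homothety_of_cmRamified_of_sqrt (hCM : W.HasCM) (h5 : 5 ≤ p)
    (hram : CMRamified W p) (hK2 : Module.finrank ℚ K = 2) (hKp : ∀ y : K, y ^ 2 ≠ -(p : K))
    {M : ℕ} (hM : 1 ≤ M) :
    ∃ (g₀ : absoluteGaloisGroup K) (d : ℤ), IsCoprime (d - 1) ((p ^ M : ℕ) : ℤ) ∧
      (∀ P : geomTorsion (W.baseChange K) ((p ^ M : ℕ) : ℤ), g₀ • P = d • P) ∧
      subgroupResKer (geomTorsion (W.baseChange K) ((p ^ M : ℕ) : ℤ))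
        (torsionFixing (W.baseChange K) ((p ^ M : ℕ) : ℤ)) = ⊥ := by
  obtain ⟨g, d, hd1, hg⟩ := exists_restrict_smul_eq_of_cmRamified W p K hCM h5 hram hK2 hKp
  obtain ⟨hcop, hpow⟩ := homothety_pow_of_level_one W p K hd1 hg hM
  haveI : (W.baseChange K).IsElliptic := by unfold WeierstrassCurve.baseChange; infer_instance
  exact ⟨g ^ (p ^ (M - 1)), d ^ (p ^ (M - 1)), hcop, hpow,
    subgroupResKer_torsionFixing_eq_bot_of_smul_eq (W.baseChange K) (pow_ne_zero M hp.out.ne_zero)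
      hpow hcop⟩

end Assembly

end Summit.BirchSwinnertonDyer.BirchSwinnertonDyer.Theorems.PrintCFram.BorelHomothety

end
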